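import Mathlib
import Summits.Parity.GeneralizedHardyLittlewood.Theorems.ParityLeakOneFifthPlainSplitCalibReduction
import Summits.Parity.GeneralizedHardyLittlewood.Theorems.ParityLeakOneFifthParityLeakSieveCensus
import Summits.Parity.GeneralizedHardyLittlewood.Theorems.ParityLeakOneFifthParityLeakSieveErrCellsB
import Summits.Parity.GeneralizedHardyLittlewood.Theorems.ParityLeakOneFifthParityLeakSieveTypeI
import HarnessLib

/-!
# Route ParityLeakOneFifth, crux `ParityLeakSieve` (stmt-Parity-18381), skeleton `birth`:
# stub S1 `stub_sieveLowerBound` — the lower-bound sieve transferred to the host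

`𝔐 − W_Φ − δ·x/log x ≤ T(x) = Σ_{x<p≤2x, p+2 prime} log p`, where `𝔐 = Σ b Ψ(n+2)` and
`W_Φ = Σ Φ(n+2)(a − b)` (route dictionary: `a = log·1_prime`, `b = 1[n z-rough]/V`,
`Φ = 1[w ≤ P⁻ < y]·G`, `Ψ = 1[y ≤ P⁻]·G`, `G(m) = Σ_{d ∣ m, d ≤ D, d y-rough} μ(d)`).  Proof:
`1[w ≤ P⁻]·G = Φ + Ψ` pointwise (`w ≤ y`), so `𝔐 − W_Φ = Σ aΨ − Σ (a − b)·1[w ≤ P⁻(n+2)]G(n+2)`;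
the second sum is `o(x/log x)` (`typeI_diff_le`, the Type-I comparison with Bombieri–Vinogradov);
and pointwise on `y`-rough shifts `G(m) ≤ 1[m prime] + 1[D < P⁻(m), Ω = 2] + 32·1[Ω = 5] +
32·1[m not squarefree]` (`truncMoebius_le`), whose host sums beyond the twin term are `o(x/log x)`
(`host_err_le`).
-/

namespace Summit.Parity.GeneralizedHardyLittlewood.Theorems.ParityLeakOneFifth

open Finset Real
open scoped ArithmeticFunction.Omega ArithmeticFunction.Moebius
open Literature.NumberTheory.Sieve

/-- Growth: `2x + 2 ≤ D²·y` for `D = x^{1/2−2ε}`, `y = x^{1/5}`, `ε ≤ 1/25`, `x ≥ 2^100`. -/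
theorem two_mul_add_two_le_D_sq_mul_y {ε : ℝ} (hε' : ε ≤ 1 / 25) {x : ℕ} (hx : 2 ^ 100 ≤ x) :
    2 * (x : ℝ) + 2 ≤ ((x : ℝ) ^ ((1 : ℝ) / 2 - 2 * ε)) ^ 2 * (x : ℝ) ^ ((1 : ℝ) / 5) := by
  have hx1 : (1 : ℝ) < x := by
    have : (2 : ℕ) ^ 100 ≤ x := hx
    have h2 : 1 < (2 : ℕ) ^ 100 := by norm_num
    exact_mod_cast h2.trans_le this
  have hx0 : (0 : ℝ) < x := by linarith
  have h50 := four_le_rpow_fiftieth hx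
  have eD2 : ((x : ℝ) ^ ((1 : ℝ) / 2 - 2 * ε)) ^ 2 = (x : ℝ) ^ (1 - 4 * ε) := by
    rw [← Real.rpow_natCast, ← Real.rpow_mul hx0.le]; ring_nf
  rw [eD2, ← Real.rpow_add hx0]
  have h1 : (x : ℝ) ^ (1 + (1 : ℝ) / 50) ≤ (x : ℝ) ^ (1 - 4 * ε + 1 / 5) :=
    Real.rpow_le_rpow_of_exponent_le hx1.le (by linarith)
  have h2 : (x : ℝ) ^ (1 + (1 : ℝ) / 50) = x * (x : ℝ) ^ ((1 : ℝ) / 50) := by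
    rw [Real.rpow_add hx0, Real.rpow_one]
  nlinarith

/-- `1[w ≤ P⁻(m)]·G(m) = Φ(m) + Ψ(m)` for `w ≤ y`. -/
theorem theta_eq_Phi_add_Psi {w y : ℝ} (hwy : w ≤ y) (G : ℕ → ℝ) (m : ℕ) :
    (if w ≤ (m.minFac : ℝ) then G m else 0) =
      (if w ≤ (m.minFac : ℝ) ∧ (m.minFac : ℝ) < y then G m else 0) +
        (if y ≤ (m.minFac : ℝ) then G m else 0) := by
  by_cases h1 : w ≤ (m.minFac : ℝ)
  · by_cases h2 : (m.minFac : ℝ) < y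
    · rw [if_pos h1, if_pos ⟨h1, h2⟩, if_neg (not_le.2 h2), add_zero]
    · rw [if_pos h1, if_neg (fun h => h2 h.2), if_pos (not_lt.1 h2), zero_add]
  · have h2 : ¬ y ≤ (m.minFac : ℝ) := fun h => h1 (hwy.trans h)
    rw [if_neg h1, if_neg (fun h => h1 h.1), if_neg h2, add_zero]

set_option maxHeartbeats 1600000 in
/-- The lower-bound sieve with the route's `z, V, G` as parameters: for every `δ > 0` there is
`ε₂ > 0` such that for `0 < ε ≤ ε₂` and `x ≥ x₀(ε)`, `𝔐 − W_Φ − δ·x/log x ≤ T(x)`. -/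
theorem sieveLowerBound_param : ∀ δ : ℝ, 0 < δ → ∃ ε₂ : ℝ, 0 < ε₂ ∧ ∀ ε : ℝ, 0 < ε → ε ≤ ε₂ →
    ∃ x₀ : ℕ, ∀ x : ℕ, x₀ ≤ x → ∀ (z V : ℝ) (G : ℕ → ℝ),
      z = Real.exp (Real.log (Real.log (x : ℝ)) ^ 2) →
      V = ∏ p ∈ (Finset.range ⌈z⌉₊).filter Nat.Prime, (1 - 1 / (p : ℝ)) →
      G = (fun m : ℕ => ∑ d ∈ (Nat.divisors m).filter (fun d : ℕ => (d : ℝ) ≤ (x : ℝ) ^ ((1 : ℝ) / 2 - 2 * ε) ∧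
        ∀ p ∈ d.primeFactors, (x : ℝ) ^ ((1 : ℝ) / 5) ≤ (p : ℝ)), (ArithmeticFunction.moebius d : ℝ)) →
      (∑ n ∈ Finset.Ioc x (2 * x), (if ∀ p ∈ n.primeFactors, z ≤ (p : ℝ) then 1 / V else 0) *
          (if (x : ℝ) ^ ((1 : ℝ) / 5) ≤ ((n + 2).minFac : ℝ) then G (n + 2) else 0)) -
      (∑ n ∈ Finset.Ioc x (2 * x),
          (if (x : ℝ) ^ (ε ^ 2) ≤ ((n + 2).minFac : ℝ) ∧ ((n + 2).minFac : ℝ) < (x : ℝ) ^ ((1 : ℝ) / 5)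
            then G (n + 2) else 0) *
          ((if n.Prime then Real.log (n : ℝ) else 0) -
            (if ∀ p ∈ n.primeFactors, z ≤ (p : ℝ) then 1 / V else 0))) -
      δ * (x : ℝ) / Real.log (x : ℝ) ≤
      ∑ n ∈ (Finset.Ioc x (2 * x)).filter (fun n : ℕ => n.Prime ∧ (n + 2).Prime), Real.log (n : ℝ) := by
  intro δ hδ
  obtain ⟨ε₀, hε₀, hT⟩ := typeI_diff_le (δ / 2) (by positivity)
  obtain ⟨ε₁, hε₁, hH⟩ := host_err_le (δ / 2) (by positivity)
  refine ⟨min ε₀ (min ε₁ (1 / 25)), by positivity, fun ε hε hεle => ?_⟩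
  have hεε₀ : ε ≤ ε₀ := hεle.trans (min_le_left _ _)
  have hεε₁ : ε ≤ ε₁ := hεle.trans ((min_le_right _ _).trans (min_le_left _ _))
  have hε25 : ε ≤ 1 / 25 := hεle.trans ((min_le_right _ _).trans (min_le_right _ _))
  obtain ⟨x₁, hx₁⟩ := hT ε hε hεε₀
  obtain ⟨x₂, hx₂⟩ := hH ε hε hεε₁
  refine ⟨max (max x₁ x₂) (2 ^ 100), fun x hx => ?_⟩
  intro z V G hz hV hG
  have hxx₁ : x₁ ≤ x := ((le_max_left _ _).trans (le_max_left _ _)).trans hx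
  have hxx₂ : x₂ ≤ x := ((le_max_right _ _).trans (le_max_left _ _)).trans hx
  have hx100 : 2 ^ 100 ≤ x := (le_max_right _ _).trans hx
  obtain ⟨hy1, hD1, hwy, hDy3, hD2x, -, hy6, hDy, -⟩ := calib_growth hε hε25 hx100
  have hD2y := two_mul_add_two_le_D_sq_mul_y hε25 hx100
  have hT' := hx₁ x hxx₁ z V G hz hV hG
  have hH' := hx₂ x hxx₂
  set y : ℝ := (x : ℝ) ^ ((1 : ℝ) / 5) with hy
  set D : ℝ := (x : ℝ) ^ ((1 : ℝ) / 2 - 2 * ε) with hD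
  set w : ℝ := (x : ℝ) ^ (ε ^ 2) with hw
  have hy0 : 0 < y := by linarith
  obtain ⟨X, hX⟩ : ∃ v : ℝ, v = (x : ℝ) / Real.log (x : ℝ) := ⟨_, rfl⟩
  rw [mul_div_assoc, ← hX] at hT' hH' ⊢
  -- `Σ (a − b)·1[w ≤ P⁻]G = W_Φ + Σ aΨ − 𝔐`
  have hsplit : ∑ n ∈ Finset.Ioc x (2 * x), ((if n.Prime then Real.log (n : ℝ) else 0) -
      (if ∀ p ∈ n.primeFactors, z ≤ (p : ℝ) then 1 / V else 0)) *
      (if w ≤ ((n + 2).minFac : ℝ) then G (n + 2) else 0) =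
      (∑ n ∈ Finset.Ioc x (2 * x),
          (if w ≤ ((n + 2).minFac : ℝ) ∧ ((n + 2).minFac : ℝ) < y then G (n + 2) else 0) *
          ((if n.Prime then Real.log (n : ℝ) else 0) -
            (if ∀ p ∈ n.primeFactors, z ≤ (p : ℝ) then 1 / V else 0))) +
      ((∑ n ∈ Finset.Ioc x (2 * x), (if n.Prime then Real.log (n : ℝ) else 0) *
          (if y ≤ ((n + 2).minFac : ℝ) then G (n + 2) else 0)) -
        ∑ n ∈ Finset.Ioc x (2 * x), (if ∀ p ∈ n.primeFactors, z ≤ (p : ℝ) then 1 / V else 0) *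
          (if y ≤ ((n + 2).minFac : ℝ) then G (n + 2) else 0)) := by
    rw [← Finset.sum_sub_distrib, ← Finset.sum_add_distrib]
    refine Finset.sum_congr rfl fun n _ => ?_
    rw [theta_eq_Phi_add_Psi hwy G (n + 2)]; ring
  -- the pointwise lower-bound sieve on the host
  have hpt : ∀ n ∈ Finset.Ioc x (2 * x),
      (if n.Prime then Real.log (n : ℝ) else 0) * (if y ≤ ((n + 2).minFac : ℝ) then G (n + 2) else 0) ≤
      (if n.Prime ∧ (n + 2).Prime then Real.log (n : ℝ) else 0) +
      (if n.Prime ∧ D < ((n + 2).minFac : ℝ) ∧ Ω (n + 2) = 2 then Real.log (n : ℝ) else 0) +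
      32 * (if n.Prime ∧ y ≤ ((n + 2).minFac : ℝ) ∧ Ω (n + 2) = 5 then Real.log (n : ℝ) else 0) +
      32 * (if n.Prime ∧ y ≤ ((n + 2).minFac : ℝ) ∧ ¬ Squarefree (n + 2)
        then Real.log (n : ℝ) else 0) := by
    intro n hn
    rw [Finset.mem_Ioc] at hn
    have hlog0 : 0 ≤ Real.log (n : ℝ) := Real.log_nonneg (by exact_mod_cast (by omega : 1 ≤ n))
    by_cases hp : n.Prime
    · by_cases hmf : y ≤ ((n + 2).minFac : ℝ)
      · have hm0 : n + 2 ≠ 0 := by omega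
        have hrm : ∀ p ∈ (n + 2).primeFactors, y ≤ (p : ℝ) := by
          intro p hp'
          have h := Nat.minFac_le_of_dvd (Nat.prime_of_mem_primeFactors hp').two_le
            (Nat.dvd_of_mem_primeFactors hp')
          exact hmf.trans (by exact_mod_cast h)
        have hGm : G (n + 2) = ∑ d ∈ (Nat.divisors (n + 2)).filter (fun d : ℕ => (d : ℝ) ≤ D),
            (μ d : ℝ) := by
          rw [hG]; simp only []; rw [filter_divisors_rough_eq hrm hm0]
        have hmx : ((n + 2 : ℕ) : ℝ) ≤ 2 * (x : ℝ) + 2 := by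
          exact_mod_cast (by omega : n + 2 ≤ 2 * x + 2)
        have hmx' : (x : ℝ) < ((n + 2 : ℕ) : ℝ) := by exact_mod_cast (by omega : x < n + 2)
        have hΩ5 := cardFactors_le_five_of_rough hm0 hy1 hrm (by linarith)
        have h3 : Ω (n + 2) = 3 → ((n + 2 : ℕ) : ℝ) ≤ D ^ 2 * y := fun _ => by linarith
        have h4 : Ω (n + 2) = 4 → ∀ p ∈ (n + 2).primeFactors, (p : ℝ) ≤ D := by
          intro _ p hp'
          have hpp := Nat.prime_of_mem_primeFactors hp'
          have hpd := Nat.dvd_of_mem_primeFactors hp'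
          refine le_of_cofactor_three hm0 hy0 hpd hrm ?_ (by linarith)
          have hk0 : (n + 2) / p ≠ 0 := by
            intro h; exact hm0 (by rw [← Nat.mul_div_cancel' hpd, h, mul_zero])
          have e' := ArithmeticFunction.cardFactors_mul (m := p) (n := (n + 2) / p) hpp.ne_zero hk0
          rw [Nat.mul_div_cancel' hpd, ArithmeticFunction.cardFactors_apply_prime hpp] at e'
          omega
        have hG' := truncMoebius_le (m := n + 2) (by omega) hy1 hD1 hDy3 (by linarith) hrm hΩ5 h3 h4
        rw [← hGm] at hG'
        rw [if_pos hp, if_pos hmf]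
        have e : (if n.Prime ∧ (n + 2).Prime then Real.log (n : ℝ) else 0) +
            (if n.Prime ∧ D < ((n + 2).minFac : ℝ) ∧ Ω (n + 2) = 2 then Real.log (n : ℝ) else 0) +
            32 * (if n.Prime ∧ y ≤ ((n + 2).minFac : ℝ) ∧ Ω (n + 2) = 5 then Real.log (n : ℝ) else 0) +
            32 * (if n.Prime ∧ y ≤ ((n + 2).minFac : ℝ) ∧ ¬ Squarefree (n + 2)
              then Real.log (n : ℝ) else 0) =
            Real.log (n : ℝ) * ((if (n + 2).Prime then (1 : ℝ) else 0) +
              (if D < ((n + 2).minFac : ℝ) ∧ Ω (n + 2) = 2 then 1 else 0) +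
              32 * (if Ω (n + 2) = 5 then 1 else 0) + 32 * (if ¬ Squarefree (n + 2) then 1 else 0)) := by
          simp only [hp, hmf, true_and]
          split_ifs <;> ring
        rw [e]
        exact mul_le_mul_of_nonneg_left hG' hlog0
      · rw [if_pos hp, if_neg hmf, mul_zero]
        have h1 : 0 ≤ (if n.Prime ∧ (n + 2).Prime then Real.log (n : ℝ) else 0) := by
          split_ifs <;> linarith
        have h2 : 0 ≤ (if n.Prime ∧ D < ((n + 2).minFac : ℝ) ∧ Ω (n + 2) = 2
            then Real.log (n : ℝ) else 0) := by
          split_ifs <;> linarith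
        have h3 : 0 ≤ (if n.Prime ∧ y ≤ ((n + 2).minFac : ℝ) ∧ Ω (n + 2) = 5
            then Real.log (n : ℝ) else 0) := by
          split_ifs <;> linarith
        have h4 : 0 ≤ (if n.Prime ∧ y ≤ ((n + 2).minFac : ℝ) ∧ ¬ Squarefree (n + 2)
            then Real.log (n : ℝ) else 0) := by
          split_ifs <;> linarith
        linarith
    · simp [hp]
  have hsum := Finset.sum_le_sum hpt
  rw [Finset.sum_add_distrib, Finset.sum_add_distrib, Finset.sum_add_distrib, ← Finset.mul_sum,
    ← Finset.mul_sum, ← Finset.sum_filter, ← Finset.sum_filter, ← Finset.sum_filter,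
    ← Finset.sum_filter] at hsum
  have hT'' := (abs_le.1 hT').1
  linarith [hsplit, hT'', hsum, hH']

/-- **Stub S1 `stub_sieveLowerBound`** of skeleton `birth` (crux `ParityLeakSieve`,
stmt-Parity-18381), verbatim: the `(1/2 − ν)`-level lower-bound sieve transferred to the host,
`𝔐 − W_Φ − δ·x/log x ≤ T(x)` for `0 < ε ≤ ε₂(δ)` and `x ≥ x₀(ε)`. -/
theorem stub_sieveLowerBound : ∀ δ : ℝ, 0 < δ → ∃ ε₂ : ℝ, 0 < ε₂ ∧ ∀ ε : ℝ, 0 < ε → ε ≤ ε₂ → ∃ x₀ : ℕ, ∀ x : ℕ, x₀ ≤ x → (fun (b a Φ Ψ : ℕ → ℝ) => (∑ n ∈ Finset.Ioc x (2 * x), b n * Ψ (n + 2)) - (∑ n ∈ Finset.Ioc x (2 * x), Φ (n + 2) * (a n - b n)) - δ * (x : ℝ) / Real.log (x : ℝ) ≤ ∑ n ∈ (Finset.Ioc x (2 * x)).filter (fun n : ℕ => n.Prime ∧ (n + 2).Prime), Real.log (n : ℝ)) (fun n : ℕ => if ∀ p ∈ n.primeFactors, Real.exp (Real.log (Real.log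 (x : ℝ)) ^ 2) ≤ (p : ℝ) then 1 / (∏ p ∈ (Finset.range ⌈Real.exp (Real.log (Real.log (x : ℝ)) ^ 2)⌉₊).filter Nat.Prime, (1 - 1 / (p : ℝ))) else 0) (fun n : ℕ => if n.Prime then Real.log (n : ℝ) else 0) (fun m : ℕ => if (x : ℝ) ^ (ε ^ 2) ≤ (m.minFac : ℝ) ∧ (m.minFac : ℝ) < (x : ℝ) ^ ((1 : ℝ) / 5) then ∑ d ∈ (Nat.divisors m).filter (fun d : ℕ => (d : ℝ) ≤ (x : ℝ) ^ ((1 : ℝ) / 2 - 2 * ε) ∧ ∀ p ∈ d.primeFactors, (x : ℝ) ^ ((1 : ℝ) / 5) ≤ (p : ℝ)), (ArithmeticFunction.moebius d : ℝ) else 0) (fun m : ℕ => if (x : ℝ) ^ ((1 : ℝ) / 5) ≤ (m.minFac : ℝ) then ∑ d ∈ (Nat.divisors m).filter (fun d : ℕ => (d : ℝ) ≤ (x : ℝ) ^ ((1 : ℝ) / 2 - 2 * ε) ∧ ∀ p ∈ d.primeFactors, (x : ℝ) ^ ((1 : ℝ) / 5) ≤ (p : ℝ)), (ArithmeticFunction.moebius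 d : ℝ) else 0) := by
  intro δ hδ
  obtain ⟨ε₂, hε₂, h⟩ := sieveLowerBound_param δ hδ
  refine ⟨ε₂, hε₂, fun ε hε hεle => ?_⟩
  obtain ⟨x₀, hx₀⟩ := h ε hε hεle
  refine ⟨x₀, fun x hx => ?_⟩
  beta_reduce
  exact hx₀ x hx _ _ (fun m : ℕ => ∑ d ∈ (Nat.divisors m).filter (fun d : ℕ =>
    (d : ℝ) ≤ (x : ℝ) ^ ((1 : ℝ) / 2 - 2 * ε) ∧ ∀ p ∈ d.primeFactors, (x : ℝ) ^ ((1 : ℝ) / 5) ≤ (p : ℝ)),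
      (ArithmeticFunction.moebius d : ℝ)) rfl rfl rfl

end Summit.Parity.GeneralizedHardyLittlewood.Theorems.ParityLeakOneFifth
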